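import Summits.Ventures.CertifiedArithmetic.LowPrec.SROptimal
import HarnessLib

/-!
# Stochastic rounding in low-precision formats LXII — ONE RANDOM DRAW PER BLOCK (i): the prefix-scan
# ("systematic") coupling of the stochastic roundings of a block keeps every element EXACTLY
# `SR_N`-distributed, and every prefix count within `1 − 2^{-N}` of its mean, SURELY

HONEST FRAMING: certified error envelopes and provably optimal rounding/accumulation schemes for
low-precision formats under stated cost models; every table by two implementations; no hardware or
vendor claims.

COST MODEL: random bits consumed per block of `n` roundings (plus one integer adder per element).
Independent `N`-bit SR (files XX–XXII, LV) spends `n·N` bits.  Here ONE draw `R`, uniform on `[0, m)`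
(`m = 2^N`; any `m > 0` works), is SHARED by the whole block through a running prefix sum: element `i`,
with residual `θᵢ = tᵢ/m` (`tᵢ ≤ m`), rounds UP iff the prefix count jumps,
`Bᵢ(R) = ⌊(Cᵢ₊₁ + R)/m⌋ − ⌊(Cᵢ + R)/m⌋`, `Cₖ = t₀ + ⋯ + tₖ₋₁` (`pre`, `cnt`, `sysUp`).  Expectations over
the draw are the plain sums `∑_{R<m}` (divide by `m`).
1. MARGINALS ARE EXACT (`sum_sysUp_marginal`, `card_sysUp_eq_one`): `#{R < m : Bᵢ(R) = 1} = tᵢ` — each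
   element ALONE is exactly the `N`-bit stochastic rounding with up-probability `θᵢ`, so every single-
   operation statement of files IV–LXI (unbiasedness on `N`-bit residuals, the CHM21 variance, optimality
   LV) is inherited verbatim; only the JOINT law of the block changes.  (Hermite's counting identity
   `∑_{R<m} ⌊(a+R)/m⌋ = a`, `sum_add_div`.)
2. PREFIX COUNTS (`sum_sysUp_eq_cnt`, `cnt_eq_div_add`, `sum_fun_cnt`): for every `k` and EVERY draw the
   number of up-roundings among the first `k` elements is `⌊(Cₖ+R)/m⌋ ∈ {⌊Cₖ/m⌋, ⌊Cₖ/m⌋ + 1}`, the larger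
   value on exactly `r = Cₖ mod m` of the `m` draws.  The discrepancy `Dₖ(R) = ⌊(Cₖ+R)/m⌋ − Cₖ/m`
   (`disc`) therefore has the two-point law `{−r/m ↦ (m−r)/m, (m−r)/m ↦ r/m}` (`disc_eq_ite`,
   `sum_fun_disc`): `∑_R Dₖ = 0` (`sum_disc`), `∑_R Dₖ² = r(m−r)/m ≤ m/4` (`sum_disc_sq`,
   `sum_disc_sq_le`), and the SURE bound `|Dₖ(R)| ≤ 1 − 1/m` for every draw (`abs_disc_le`) — against
   `√k/2` RMS and `k/2`-scale sure deviations for `k` independent roundings.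
File LXIII (`LowPrec/SRCoupledBlockError`) turns 2 into the block-SUM law with unequal gaps (Abel
summation): `E e = 0`, `|e| ≤ (1 − 2^{-N})·G₀` surely, `E e² ≤ G₀²/4`, all free of `n`, with a kernel-
checked E2M1 block; file LXIV the optimality of this coupling for the block sum among ALL couplings with
`SR` marginals and the opposite verdict (independent SR minimax) for sign-indefinite functionals.
NOT CLAIMED: anything for data-dependent (recursive) accumulation — the shared draw must not be consumed
adaptively (a one-register adaptive dither is biased); non-`N`-bit residuals (first quantise `θ` to `N`
bits: files XX–XXII, LVIII bound that bias, which the coupling leaves unchanged).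
Prior art: randomized roundings of an `ℓ`-bit matrix all of whose initial row/column interval sums are
themselves randomized roundings, computable in time `O(mnℓ)` [DoerrEtAl2006, Def. 2, Thm. 3] (a sequence
is one row; sure discrepancy `< 1`); systematic PPS sampling [Madow1949]; unbiased controlled rounding
[Cox1987]; correlated quantisers for DISTRIBUTED mean estimation [SureshEtAl2022, Thm. 2] (error `O(1/n)`;
their lower bounds, Thm. 4–5, concern oblivious protocols and do not cover a shared prefix scan).  The
floating-point reading — exact `SR_N` marginals at the cost of `N` bits per BLOCK — and the `1 − 1/m`
constants are new as far as searched (FRESHNESS-SR K); the construction itself is the classical one.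
-/

namespace Summit.Ventures.CertifiedArithmetic.LowPrec.SR

open Finset

namespace Coupled

/-! ### Integer layer: prefix counts under one shared draw -/

/-- Prefix numerator `Cₖ = t₀ + ⋯ + tₖ₋₁` of the residual numerators (`θᵢ = tᵢ/m`). -/
def pre (t : ℕ → ℕ) (k : ℕ) : ℕ := ∑ i ∈ range k, t i

/-- `cnt m t R k = ⌊(Cₖ + R)/m⌋`: the number of up-roundings among the first `k` elements under the
shared draw `R`. -/
def cnt (m : ℕ) (t : ℕ → ℕ) (R k : ℕ) : ℕ := (pre t k + R) / m

/-- The rounding bit of element `i` under the shared draw `R`: `Bᵢ(R) = cnt (i+1) − cnt i ∈ {0, 1}`. -/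
def sysUp (m : ℕ) (t : ℕ → ℕ) (R i : ℕ) : ℕ := cnt m t R (i + 1) - cnt m t R i

/-- `C₀ = 0`. -/
theorem pre_zero (t : ℕ → ℕ) : pre t 0 = 0 := by simp [pre]

/-- `Cₖ₊₁ = Cₖ + tₖ`. -/
theorem pre_succ (t : ℕ → ℕ) (k : ℕ) : pre t (k + 1) = pre t k + t k := by
  simp [pre, sum_range_succ]

/-- The prefix count is monotone in `k`. -/
theorem cnt_monotone (m : ℕ) (t : ℕ → ℕ) (R : ℕ) : Monotone (cnt m t R) := by
  refine monotone_nat_of_le_succ fun k => ?_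
  unfold cnt
  exact Nat.div_le_div_right (by rw [pre_succ]; omega)

/-- No up-rounding before the first element (`R < m`). -/
theorem cnt_zero {m R : ℕ} (t : ℕ → ℕ) (hR : R < m) : cnt m t R 0 = 0 := by
  simp [cnt, pre_zero, Nat.div_eq_of_lt hR]

/-- `Bᵢ ≤ 1` as soon as `tᵢ ≤ m` (`θᵢ ≤ 1`). -/
theorem sysUp_le_one {m : ℕ} {t : ℕ → ℕ} (hm : 0 < m) {i : ℕ} (ht : t i ≤ m) (R : ℕ) :
    sysUp m t R i ≤ 1 := by
  unfold sysUp cnt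
  rw [pre_succ]
  have h : (pre t i + t i + R) / m ≤ (pre t i + R + m) / m := Nat.div_le_div_right (by omega)
  rw [Nat.add_div_right _ hm] at h
  omega

/-- The rounding bits telescope to the prefix count: `∑_{i<k} Bᵢ(R) = ⌊(Cₖ + R)/m⌋` (`R < m`). -/
theorem sum_sysUp_eq_cnt {m R : ℕ} (t : ℕ → ℕ) (hR : R < m) (k : ℕ) :
    ∑ i ∈ range k, sysUp m t R i = cnt m t R k := by
  unfold sysUp
  rw [sum_range_tsub (cnt_monotone m t R), cnt_zero t hR, Nat.sub_zero]

/-- Hermite's identity in counting form: `∑_{R<m} ⌊(a+R)/m⌋ = a`. -/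
theorem sum_add_div (a : ℕ) {m : ℕ} (hm : 0 < m) : ∑ R ∈ range m, (a + R) / m = a := by
  induction a with
  | zero => exact sum_eq_zero fun R hR => by simpa using Nat.div_eq_of_lt (mem_range.mp hR)
  | succ a ih =>
    have h1 : ∑ R ∈ range (m + 1), (a + R) / m = a + (a / m + 1) := by
      rw [sum_range_succ, ih, Nat.add_div_right _ hm]
    have h2 : ∑ R ∈ range (m + 1), (a + R) / m = ∑ R ∈ range m, (a + 1 + R) / m + a / m := by
      rw [sum_range_succ', Nat.add_zero]
      congr 1
      exact sum_congr rfl fun R _ => by rw [show a + (R + 1) = a + 1 + R by omega]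
    omega

/-- `∑_{R<m} ⌊(Cₖ+R)/m⌋ = Cₖ`. -/
theorem sum_cnt {m : ℕ} (hm : 0 < m) (t : ℕ → ℕ) (k : ℕ) :
    ∑ R ∈ range m, cnt m t R k = pre t k :=
  sum_add_div (pre t k) hm

/-- **Exact marginals.** `∑_{R<m} Bᵢ(R) = tᵢ`: over the `m` equally likely draws element `i` rounds up
exactly `tᵢ` times — taken alone it is EXACTLY the `N`-bit stochastic rounding with up-probability
`θᵢ = tᵢ/m`. [new reading; the construction is that of DoerrEtAl2006, Thm. 3 / Madow1949] -/
theorem sum_sysUp_marginal {m : ℕ} (hm : 0 < m) (t : ℕ → ℕ) (i : ℕ) :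
    ∑ R ∈ range m, sysUp m t R i = t i := by
  unfold sysUp
  rw [sum_tsub_distrib _ fun R _ => cnt_monotone m t R (Nat.le_succ i), sum_cnt hm, sum_cnt hm,
    pre_succ, Nat.add_sub_cancel_left]

/-- The same as a count of draws: `#{R < m : Bᵢ(R) = 1} = tᵢ` (`tᵢ ≤ m`). -/
theorem card_sysUp_eq_one {m : ℕ} (hm : 0 < m) {t : ℕ → ℕ} {i : ℕ} (ht : t i ≤ m) :
    ((range m).filter fun R => sysUp m t R i = 1).card = t i := by
  rw [card_filter, ← sum_sysUp_marginal hm t i]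
  refine sum_congr rfl fun R _ => ?_
  rcases Nat.le_one_iff_eq_zero_or_eq_one.mp (sysUp_le_one hm ht R) with h | h <;> simp [h]

/-- The prefix count splits as quotient plus a carry bit:
`⌊(Cₖ+R)/m⌋ = ⌊Cₖ/m⌋ + [m ≤ (Cₖ mod m) + R]` (`R < m`). -/
theorem cnt_eq_div_add {m R : ℕ} (hm : 0 < m) (hR : R < m) (t : ℕ → ℕ) (k : ℕ) :
    cnt m t R k = pre t k / m + if m ≤ pre t k % m + R then 1 else 0 := by
  unfold cnt
  have hr : pre t k % m < m := Nat.mod_lt _ hm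
  have hC : pre t k + R = m * (pre t k / m) + (pre t k % m + R) := by
    have := Nat.div_add_mod (pre t k) m
    omega
  rw [hC, Nat.mul_add_div hm]
  congr 1
  split_ifs with h
  · exact Nat.div_eq_of_lt_le (by omega) (by omega)
  · exact Nat.div_eq_of_lt (by omega)

/-- **Two-point law of the prefix count.**  Over the `m` draws, `⌊(Cₖ+R)/m⌋` equals `q = ⌊Cₖ/m⌋` on
`m − r` draws and `q + 1` on `r = Cₖ mod m` draws. -/
theorem sum_fun_cnt {m : ℕ} (hm : 0 < m) (t : ℕ → ℕ) (k : ℕ) {α : Type*} [AddCommMonoid α]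
    (f : ℕ → α) :
    ∑ R ∈ range m, f (cnt m t R k) =
      (m - pre t k % m) • f (pre t k / m) + (pre t k % m) • f (pre t k / m + 1) := by
  have hr : pre t k % m < m := Nat.mod_lt _ hm
  have key : ∀ g : ℕ → α, ∑ R ∈ range m, g R =
      ∑ R ∈ range (m - pre t k % m), g R + ∑ j ∈ range (pre t k % m), g (m - pre t k % m + j) := by
    intro g
    rw [← sum_range_add, Nat.sub_add_cancel hr.le]
  rw [key]
  have h1 : ∑ R ∈ range (m - pre t k % m), f (cnt m t R k) =
      ∑ R ∈ range (m - pre t k % m), f (pre t k / m) :=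
    sum_congr rfl fun R hR => by
      have hR := mem_range.mp hR
      rw [cnt_eq_div_add hm (by omega) t k, if_neg (by omega), Nat.add_zero]
  have h2 : ∑ j ∈ range (pre t k % m), f (cnt m t (m - pre t k % m + j) k) =
      ∑ j ∈ range (pre t k % m), f (pre t k / m + 1) :=
    sum_congr rfl fun j hj => by
      have hj := mem_range.mp hj
      rw [cnt_eq_div_add hm (by omega) t k, if_pos (by omega)]
  rw [h1, h2, sum_const, sum_const, card_range, card_range]

/-! ### Value layer: discrepancies and the block-sum error -/

section Value

variable (K : Type*) [Field K] [LinearOrder K] [IsStrictOrderedRing K]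

/-- Prefix discrepancy `Dₖ(R) = ⌊(Cₖ+R)/m⌋ − Cₖ/m`: up-roundings among the first `k` elements minus
their mean. -/
def disc (m : ℕ) (t : ℕ → ℕ) (R k : ℕ) : K := (cnt m t R k : K) - (pre t k : K) / m

variable {K}

omit [LinearOrder K] [IsStrictOrderedRing K] in
/-- `∑_{i<k} (Bᵢ − θᵢ) = Dₖ` (`R < m`). -/
theorem sum_sysUp_sub_eq_disc {m R : ℕ} (t : ℕ → ℕ) (hR : R < m) (k : ℕ) :
    ∑ i ∈ range k, ((sysUp m t R i : K) - (t i : K) / m) = disc K m t R k := by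
  rw [sum_sub_distrib, ← sum_div, ← Nat.cast_sum, ← Nat.cast_sum, sum_sysUp_eq_cnt t hR]
  rfl

/-- `D₀ = 0` (`R < m`). -/
theorem disc_zero {m R : ℕ} (t : ℕ → ℕ) (hR : R < m) : disc K m t R 0 = 0 := by
  simp [disc, cnt_zero t hR, pre_zero]

/-- Unbiased prefix counts: `∑_{R<m} Dₖ(R) = 0`. -/
theorem sum_disc {m : ℕ} (hm : 0 < m) (t : ℕ → ℕ) (k : ℕ) :
    ∑ R ∈ range m, disc K m t R k = 0 := by
  unfold disc
  rw [sum_sub_distrib, ← Nat.cast_sum, sum_cnt hm, sum_const, card_range, nsmul_eq_mul]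
  have hm' : (m : K) ≠ 0 := by exact_mod_cast hm.ne'
  field_simp
  ring

/-- The value of `Dₖ(R)`: `(m − r)/m` on a carry, `−r/m` otherwise (`r = Cₖ mod m`, `R < m`). -/
theorem disc_eq_ite {m R : ℕ} (hm : 0 < m) (hR : R < m) (t : ℕ → ℕ) (k : ℕ) :
    disc K m t R k =
      if m ≤ pre t k % m + R then ((m : K) - (pre t k % m : ℕ)) / m
      else -((pre t k % m : ℕ) : K) / m := by
  have hm' : (m : K) ≠ 0 := by exact_mod_cast hm.ne'
  have hC : (pre t k : K) = (m : K) * ((pre t k / m : ℕ) : K) + ((pre t k % m : ℕ) : K) := by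
    exact_mod_cast (Nat.div_add_mod (pre t k) m).symm
  unfold disc
  rw [cnt_eq_div_add hm hR t k, hC]
  split_ifs <;> push_cast <;> field_simp <;> ring

/-- **Two-point law of the discrepancy**: `∑_{R<m} f(Dₖ(R)) = (m−r)·f(−r/m) + r·f((m−r)/m)`,
`r = Cₖ mod m`. -/
theorem sum_fun_disc {m : ℕ} (hm : 0 < m) (t : ℕ → ℕ) (k : ℕ) (f : K → K) :
    ∑ R ∈ range m, f (disc K m t R k) =
      ((m - pre t k % m : ℕ) : K) * f (-((pre t k % m : ℕ) : K) / m)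
        + ((pre t k % m : ℕ) : K) * f (((m : K) - (pre t k % m : ℕ)) / m) := by
  have hm' : (m : K) ≠ 0 := by exact_mod_cast hm.ne'
  have hC : (pre t k : K) = (m : K) * ((pre t k / m : ℕ) : K) + ((pre t k % m : ℕ) : K) := by
    exact_mod_cast (Nat.div_add_mod (pre t k) m).symm
  have hq : ((pre t k / m : ℕ) : K) - (pre t k : K) / m = -((pre t k % m : ℕ) : K) / m := by
    rw [hC]; field_simp; ring
  have hq1 : ((pre t k / m + 1 : ℕ) : K) - (pre t k : K) / m = ((m : K) - (pre t k % m : ℕ)) / m := by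
    rw [hC]; push_cast; field_simp; ring
  have h := sum_fun_cnt hm t k (fun c => f ((c : K) - (pre t k : K) / m))
  simp only [nsmul_eq_mul] at h
  unfold disc
  rw [h, hq, hq1]

/-- `∑_{R<m} Dₖ(R)² = r(m−r)/m`, `r = Cₖ mod m`: the prefix count has variance `φ(1−φ)`, `φ = r/m`. -/
theorem sum_disc_sq {m : ℕ} (hm : 0 < m) (t : ℕ → ℕ) (k : ℕ) :
    ∑ R ∈ range m, (disc K m t R k) ^ 2
      = ((pre t k % m : ℕ) : K) * ((m : K) - (pre t k % m : ℕ)) / m := by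
  rw [sum_fun_disc hm t k (fun x => x ^ 2)]
  have hm' : (m : K) ≠ 0 := by exact_mod_cast hm.ne'
  have hr : pre t k % m ≤ m := (Nat.mod_lt _ hm).le
  push_cast [Nat.cast_sub hr]
  field_simp
  ring

/-- … hence `∑_{R<m} Dₖ(R)² ≤ m/4` (`φ(1−φ) ≤ 1/4`). -/
theorem sum_disc_sq_le {m : ℕ} (hm : 0 < m) (t : ℕ → ℕ) (k : ℕ) :
    ∑ R ∈ range m, (disc K m t R k) ^ 2 ≤ (m : K) / 4 := by
  rw [sum_disc_sq hm]
  have hm' : (0 : K) < m := by exact_mod_cast hm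
  rw [div_le_div_iff₀ hm' (by norm_num : (0 : K) < 4)]
  nlinarith [sq_nonneg ((m : K) - 2 * ((pre t k % m : ℕ) : K))]

/-- **SURE prefix bound**: `|Dₖ(R)| ≤ 1 − 1/m` for every draw `R < m`. -/
theorem abs_disc_le {m R : ℕ} (hm : 0 < m) (hR : R < m) (t : ℕ → ℕ) (k : ℕ) :
    |disc K m t R k| ≤ 1 - 1 / (m : K) := by
  have hm' : (0 : K) < m := by exact_mod_cast hm
  have hr : pre t k % m < m := Nat.mod_lt _ hm
  have hrK : ((pre t k % m : ℕ) : K) + 1 ≤ m := by exact_mod_cast hr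
  have h1 : (1 : K) - 1 / m = ((m : K) - 1) / m := by field_simp
  rw [disc_eq_ite hm hR t k, h1]
  split_ifs with h
  · have h1r : (1 : K) ≤ (pre t k % m : ℕ) := by exact_mod_cast (show 1 ≤ pre t k % m by omega)
    rw [abs_of_nonneg (div_nonneg (by linarith) hm'.le)]
    exact div_le_div_of_nonneg_right (by linarith) hm'.le
  · have h0r : (0 : K) ≤ (pre t k % m : ℕ) := Nat.cast_nonneg _
    rw [neg_div, abs_neg, abs_of_nonneg (div_nonneg h0r hm'.le)]
    exact div_le_div_of_nonneg_right (by linarith) hm'.le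

end Value

end Coupled

end Summit.Ventures.CertifiedArithmetic.LowPrec.SR
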